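import Summits.QuantumFields.BalabanUV.Beta.D1BFx.GramWeightColourLift

/-!
# `BalabanUV.Beta.D1BFx.PackedSlotMultilinear` — road «BF-x» for binder row D1, slot (K), chain step (I) «(A1)-PACKED», brick «SLOT-PACK»
# (`A1-PACKED-SPEC.md` v0.3.1 §6 (B5) «GRAM-COV-PACKED» ∕ «FP-PACKED-LIMIT» + §8 «COFRAME-PACK»): **THE ONE-LOOP SLOT FUNCTIONALS ARE
# BILINEAR-PACKABLE** — for RESPONSE-PACKED jets (first jets `Σ_k r k • x_k`, second jets `Σ_{k,l} r k·r′ l • x_{kl}`),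
# `hessT L V V′ W`, the twisted Gram jets `tgram₁`, `tgramMix`, and hence the «GRAM-COV» slot, are the `Σ_{k,l} r k·r′ l`-superpositions of the
# single-bond-pair values.

HONEST DEPENDENCY (cell records, verbatim): «continuum YM on T⁴ ⇐ BetaPertH ∧ nine spine estimates (0/9 proved); BetaPertH ⇐ (D1) ∧ (D4) ∧
CAP+tail; G-an2-4 gates asym, D1 and NE2/3/4.»  HONEST FRAMING (cell contract, verbatim): «discharging `BetaPertH` makes Bałaban's UV stability
UNCONDITIONAL — a real constructive-QFT result; it is NOT the continuum limit and NOT the Clay problem.»  THIS MODULE DISCHARGES NOTHING of (K),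
of D1 or of the wall: [folklore] finite (bi)linear algebra over TA4's `MixedVarPackedHess.hessT` and K-TA4C's `GramWeightColourLift.tgram₁ ∕ tgramMix`
(distribute finite sums through products, transposes, scalar multiples and the trace).  No definition, no `def … : Prop`, nothing cited, 0 sorry.
0 root-level binders of row D1 discharged; (K) NOT closed; NOT D1, NOT `BetaPertH`, NOT continuum, NOT Clay.

ABSOLUTE RULE (cell charter, verbatim): «No internally-minted statement may enter as a cited fact. Every hypothesis is either kernel-proved in this
package or a verbatim quotation of a PUBLISHED theorem with page reference. The manuscript(s) under audit are NOT citable for their own disputed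
steps — they are the thing under adjudication; programme-internal (2001/route/tribunal) claims are never citable.»

WHY (owner d1-p2 gen 17).  In (B3) «A1-PACKED-TORUS» every jet is RESPONSE-PACKED over the torus' fine bonds `k` with the torus responses `rₛ k`,
`rₜ l` ((B4b)): gauge jets `wₛ = Σ_k rₛ k • X₁ k`, `wₛₜ = Σ_{k,l} rₛ k·rₜ l • X₂ k l`, co-frame jets `Tₛ = Σ_k rₛ k • Tjet₁(b_k)`, `Aₛ`, `Tₛₜ = Σ_{k,l} … • Tjet₁₁(b_k,b_l)`,
`Aₛₜ` (TB4-W's `TorusCoframeJets` at the single bonds — «COFRAME-PACK» is this instantiation, no lemma of its own), form tables `kₛ kₛₜ` likewise.  The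
two TOWER SLOTS of `KCombineCovColourTorus.identity_array_currency_cov_What0_stripped` — «GRAM-COV»
`bΦ := hessT (gram₀ Ŵ₀ Φ₀)⁻¹ (tgram₁ Ŵ₀ wₛ Φ₀ (kₛ + tgram₁ T₀ Tₛ A₀ Aₛ)) (…ₜ) (tgramMix …)` and «COMB-FP» `eτ := hessT 1 (τwₛ) (τwₜ) (τwₛₜ)` — are identified
with arrays of `ℤ⁴` kernels only AT SINGLE BOND PAIRS (`hessT_tgramCov_What0_eq_arr`, `hessT_combFP_What0_eq_arr`).  THIS FILE is the algebra that
reduces the PACKED slots to those: the functionals are `Σ_{k,l} rₛ k·rₜ l`-superpositions of their single-pair values ((B5) then packs the right-hand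
arrays with (B4c)∕(B4e) and passes to `p → ∞` with leaf-03's `MovingTableSockets`).

CONTENT (all [folklore]; finite index type `σ` of bonds, weights `r r′ : σ → ℝ`).
* §1 `trace_mul_packed₂`, `trace_bubble_packed`, **`hessT_packed`**:
  `hessT L (Σ_k r k • V k) (Σ_l r′ l • V′ l) (Σ_{k,l} (r k·r′ l) • W k l) = Σ_{k,l} (r k·r′ l)·hessT L (V k) (V′ l) (W k l)`.
* §2 **`tgram₁_packed`** (linear), `tgramMix_sum_fst` (first-slot linearity, the three second-jet terms untouched), **`tgramMix_packed`** (bilinear + second-jet linear).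
* §3 **`hessT_tgram_packed`** — the «GRAM-COV» slot at packed jets = `Σ_{k,l} r k·r′ l •` the slot at the single pairs; `hessT_mul_packed` — the «COMB-FP» slot likewise
  (`τ·Σ = Σ τ·`).
Unit `b2b-balaban-beta-d1-p2` (road owner, gen 17), 2026-08-22.
-/

noncomputable section

namespace Summit.QuantumFields.BalabanUV.Beta.D1BFx.PackedSlotMultilinear

open Matrix
open scoped BigOperators
open Summit.QuantumFields.BalabanUV.Beta.D1BFx.MixedVarPackedHess (hessT)
open Summit.QuantumFields.BalabanUV.Beta.D1BFx.GramWeightColourLift (tgram₁ tgramMix)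

variable {ι κ ρ σ : Type*} [Fintype σ]

/-! ## §1 `hessT` is bilinear-packable -/

section HessT

variable [Fintype ι] [Fintype ρ] (L : Matrix ι ι ℝ) (r r' : σ → ℝ)

omit [Fintype ρ] in
/-- [folklore] The tadpole term at a packed second jet: `tr (L · Σ_{k,l} (r k·r′ l) • W k l) = Σ_{k,l} (r k·r′ l)·tr (L · W k l)`. -/
theorem trace_mul_packed₂ (W : σ → σ → Matrix ι ι ℝ) :
    (L * ∑ k, ∑ l, (r k * r' l) • W k l).trace = ∑ k, ∑ l, (r k * r' l) * (L * W k l).trace := by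
  simp only [Matrix.mul_sum, Matrix.mul_smul, Matrix.trace_sum, Matrix.trace_smul, smul_eq_mul]

omit [Fintype ρ] in
/-- [folklore] The bubble term at packed first jets: `tr (L·(Σ_k r k • V k)·(L·(Σ_l r′ l • V′ l))) = Σ_{k,l} (r k·r′ l)·tr (L·V k·(L·V′ l))`. -/
theorem trace_bubble_packed (V V' : σ → Matrix ι ι ℝ) :
    (L * (∑ k, r k • V k) * (L * ∑ l, r' l • V' l)).trace = ∑ k, ∑ l, (r k * r' l) * (L * V k * (L * V' l)).trace := by
  simp only [Matrix.mul_smul, Matrix.sum_mul, Matrix.smul_mul, Matrix.trace_sum, Matrix.trace_smul, smul_eq_mul, Finset.mul_sum]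
  rw [Finset.sum_comm]
  refine Finset.sum_congr rfl fun k _ => Finset.sum_congr rfl fun l _ => ?_
  ring

omit [Fintype ρ] in
/-- [folklore] **`hessT` IS BILINEAR-PACKABLE**: for packed first jets `Σ_k r k • V k`, `Σ_l r′ l • V′ l` and the packed second jet
`Σ_{k,l} (r k·r′ l) • W k l`,
`hessT L (Σ r•V) (Σ r′•V′) (Σ rr′•W) = Σ_{k,l} (r k·r′ l)·hessT L (V k) (V′ l) (W k l)`. -/
theorem hessT_packed (V V' : σ → Matrix ι ι ℝ) (W : σ → σ → Matrix ι ι ℝ) :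
    hessT L (∑ k, r k • V k) (∑ l, r' l • V' l) (∑ k, ∑ l, (r k * r' l) • W k l)
      = ∑ k, ∑ l, (r k * r' l) * hessT L (V k) (V' l) (W k l) := by
  simp only [hessT]
  rw [trace_mul_packed₂, trace_bubble_packed, ← Finset.sum_sub_distrib, Finset.mul_sum]
  refine Finset.sum_congr rfl fun k _ => ?_
  rw [← Finset.sum_sub_distrib, Finset.mul_sum]
  refine Finset.sum_congr rfl fun l _ => ?_
  ring

/-- [folklore] … with a common LEFT factor on the jets (the «COMB-FP» slot `hessT 1 (τwₛ) (τwₜ) (τwₛₜ)` at packed gauge jets). -/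
theorem hessT_mul_packed (τ : Matrix ι ρ ℝ) (w w' : σ → Matrix ρ ι ℝ) (w'' : σ → σ → Matrix ρ ι ℝ) :
    hessT L (τ * ∑ k, r k • w k) (τ * ∑ l, r' l • w' l) (τ * ∑ k, ∑ l, (r k * r' l) • w'' k l)
      = ∑ k, ∑ l, (r k * r' l) * hessT L (τ * w k) (τ * w' l) (τ * w'' k l) := by
  simp only [Matrix.mul_sum, Matrix.mul_smul]
  exact hessT_packed L r r' _ _ _

end HessT

/-! ## §2 The twisted Gram jets are (bi)linear-packable -/

section TGram

variable [Fintype ι] (W₀ : Matrix ι κ ℝ) (B₀ : Matrix ι ι ℝ) (r r' : σ → ℝ)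

/-- [folklore] **`tgram₁` IS LINEAR-PACKABLE**: `tgram₁ W₀ (Σ_k r k • w k) B₀ (Σ_k r k • b k) = Σ_k r k • tgram₁ W₀ (w k) B₀ (b k)`. -/
theorem tgram₁_packed (w : σ → Matrix ι κ ℝ) (b : σ → Matrix ι ι ℝ) :
    tgram₁ W₀ (∑ k, r k • w k) B₀ (∑ k, r k • b k) = ∑ k, r k • tgram₁ W₀ (w k) B₀ (b k) := by
  simp only [tgram₁, Matrix.transpose_sum, Matrix.transpose_smul, Matrix.sum_mul, Matrix.mul_sum, Matrix.smul_mul, Matrix.mul_smul,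
    smul_add, smul_neg, Finset.sum_add_distrib, Finset.sum_neg_distrib]

/-- [folklore] FIRST-SLOT LINEARITY of `tgramMix` (the three second-jet terms are untouched; the six first×first ∕ first×first-jet terms are linear in
the `ₛ`-pair `(wₛ, bₛ)`). -/
theorem tgramMix_sum_fst (w : σ → Matrix ι κ ℝ) (b : σ → Matrix ι ι ℝ) (wₜ wₛₜ : Matrix ι κ ℝ) (bₜ bₛₜ : Matrix ι ι ℝ) :
    tgramMix W₀ (∑ k, r k • w k) wₜ wₛₜ B₀ (∑ k, r k • b k) bₜ bₛₜ
      = wₛₜᵀ * B₀ * W₀ + W₀ᵀ * bₛₜ * W₀ + W₀ᵀ * B₀ * wₛₜ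
        + ∑ k, r k • (-((w k)ᵀ * bₜ * W₀) + -(wₜᵀ * b k * W₀) + -((w k)ᵀ * B₀ * wₜ) + -(wₜᵀ * B₀ * w k)
            + W₀ᵀ * b k * wₜ + W₀ᵀ * bₜ * w k) := by
  simp only [tgramMix, Matrix.transpose_sum, Matrix.transpose_smul, Matrix.sum_mul, Matrix.mul_sum, Matrix.smul_mul, Matrix.mul_smul,
    smul_add, smul_neg, Finset.sum_add_distrib, Finset.sum_neg_distrib]
  abel

/-- [folklore] **`tgramMix` IS BILINEAR-PACKABLE**: at packed first jets `(Σ_k r k • w k, Σ_k r k • b k)`, `(Σ_l r′ l • w′ l, Σ_l r′ l • b′ l)` and packed second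
jets `Σ_{k,l} (r k·r′ l) • w″ k l`, `Σ_{k,l} (r k·r′ l) • b″ k l`,
`tgramMix W₀ wₛ wₜ wₛₜ B₀ bₛ bₜ bₛₜ = Σ_{k,l} (r k·r′ l) • tgramMix W₀ (w k) (w′ l) (w″ k l) B₀ (b k) (b′ l) (b″ k l)`. -/
theorem tgramMix_packed (w w' : σ → Matrix ι κ ℝ) (w'' : σ → σ → Matrix ι κ ℝ) (b b' : σ → Matrix ι ι ℝ) (b'' : σ → σ → Matrix ι ι ℝ) :
    tgramMix W₀ (∑ k, r k • w k) (∑ l, r' l • w' l) (∑ k, ∑ l, (r k * r' l) • w'' k l)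
        B₀ (∑ k, r k • b k) (∑ l, r' l • b' l) (∑ k, ∑ l, (r k * r' l) • b'' k l)
      = ∑ k, ∑ l, (r k * r' l) • tgramMix W₀ (w k) (w' l) (w'' k l) B₀ (b k) (b' l) (b'' k l) := by
  rw [tgramMix_sum_fst]
  simp only [tgramMix, Matrix.transpose_sum, Matrix.transpose_smul, Matrix.sum_mul, Matrix.mul_sum, Matrix.smul_mul, Matrix.mul_smul,
    smul_add, smul_neg, smul_smul, Finset.smul_sum, Finset.sum_add_distrib, Finset.sum_neg_distrib]
  abel

end TGram

/-! ## §3 The «GRAM-COV» slot at packed jets -/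

section Slot

variable [Fintype ι] [Fintype κ] (L : Matrix κ κ ℝ) (W₀ : Matrix ι κ ℝ) (B₀ : Matrix ι ι ℝ) (r r' : σ → ℝ)

/-- [folklore] **THE «GRAM-COV» SLOT IS BILINEAR-PACKABLE**: with packed gauge jets `wₛ = Σ r•w`, `wₜ = Σ r′•w′`, `wₛₜ = Σ rr′•w″` and packed weight jets
`bₛ = Σ r•b`, `bₜ = Σ r′•b′`, `bₛₜ = Σ rr′•b″` (in (B3): `b k := kₛ^{(k)} + tgram₁ T₀ (Tjet₁ b_k) A₀ (Ajet₁ b_k)` etc., themselves `tgram₁_packed` ∕ `tgramMix_packed` of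
TB4-W's single-bond jets),
`hessT L (tgram₁ W₀ wₛ B₀ bₛ) (tgram₁ W₀ wₜ B₀ bₜ) (tgramMix W₀ wₛ wₜ wₛₜ B₀ bₛ bₜ bₛₜ) = Σ_{k,l} (r k·r′ l)·hessT L (tgram₁ W₀ (w k) B₀ (b k)) (tgram₁ W₀ (w′ l) B₀ (b′ l)) (tgramMix W₀ (w k) (w′ l) (w″ k l) B₀ (b k) (b′ l) (b″ k l))`. -/
theorem hessT_tgram_packed (w w' : σ → Matrix ι κ ℝ) (w'' : σ → σ → Matrix ι κ ℝ) (b b' : σ → Matrix ι ι ℝ)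
    (b'' : σ → σ → Matrix ι ι ℝ) :
    hessT L (tgram₁ W₀ (∑ k, r k • w k) B₀ (∑ k, r k • b k)) (tgram₁ W₀ (∑ l, r' l • w' l) B₀ (∑ l, r' l • b' l))
        (tgramMix W₀ (∑ k, r k • w k) (∑ l, r' l • w' l) (∑ k, ∑ l, (r k * r' l) • w'' k l)
          B₀ (∑ k, r k • b k) (∑ l, r' l • b' l) (∑ k, ∑ l, (r k * r' l) • b'' k l))
      = ∑ k, ∑ l, (r k * r' l) * hessT L (tgram₁ W₀ (w k) B₀ (b k)) (tgram₁ W₀ (w' l) B₀ (b' l))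
          (tgramMix W₀ (w k) (w' l) (w'' k l) B₀ (b k) (b' l) (b'' k l)) := by
  rw [tgram₁_packed, tgram₁_packed, tgramMix_packed, hessT_packed]

end Slot

end Summit.QuantumFields.BalabanUV.Beta.D1BFx.PackedSlotMultilinear

end
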